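import Mathlib
import Literature.Computability.Complexity.MatchingExtensionComplexityHolds
import Summits.PneNP.PneNP.Theorems.ConvexRankGatesConvexGateBlindUnitPotentialLP

set_option linter.dupNamespace false

/-!
# PneNP / ConvexRankGates — `ConvexGateBlind`, line strict-rank-conic-cover: the LP slice of the
unit-potential stub, now UNCONDITIONAL

Helpers (`--supports stmt-PneNP-10680`). `ConvexRankGatesConvexGateBlindUnitPotentialLP.lean` proved the
`q = 0` (LP-cone) slice of the registered stub `stub_unitPotentialHard` of the line
strict-rank-conic-cover CONDITIONALLY on Rothvoss's theorem (`stub_unitPotentialHard_lp :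
rothvoss_matching_slack_bound → …`). The named fact is now discharged
(`Literature.Computability.Complexity.rothvoss_matching_slack_bound_holds`,
`MatchingExtensionComplexityHolds.lean` — glue onto the kernel-checked §3 of Rothvoss's paper in
`Literature/Barriers/PneNP/TSPExtensionComplexityRothvoss*.lean`), so the slice holds outright:
for every `c`, eventually in `m`, the unit-potential matrix `(#(E(Q) ∖ u) - 1)_{Q,u}`
(`k = ⌈√m⌉₊`-sets `Q`, `k`-clique-free `u`) has NO non-negative factorisation with `r ≤ m^c`
terms — the `ε = 1` endpoint of the canonical family of the crux, LP part, unconditionally (indeed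
with `2^{Ω(√m)}` in place of `m^c`, via the read-once projection PERFECT-MATCHING ≤ CLIQUE of
`…MatchingMinor.lean`). What remains of `stub_unitPotentialHard` is its PSD part (`q > 0`).
[Rothvoss 2017, Thm. 1; this route's MatchingHost/MatchingMinor/UnitPotentialLP files]
-/

namespace Summit.PneNP.PneNP.Cruxes.ConvexGateBlind.StrictRankConicCover

open Filter

/-- **The LP slice of `stub_unitPotentialHard`, unconditionally**: for every `c`, eventually in
`m`, `¬ ConeFactorisable m ⌈√m⌉₊ 0 r 1 1` for all `r ≤ m^c` (`stub_unitPotentialHard_lp` with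
Rothvoss's theorem supplied by `rothvoss_matching_slack_bound_holds`). [Rothvoss 2017, Thm. 1] -/
theorem unitPotentialHard_lp :
    ∀ c : ℕ, ∀ᶠ m : ℕ in atTop, ∀ r : ℕ, r ≤ m ^ c →
      ¬ ConeFactorisable m ⌈(m : ℝ) ^ (1 / 2 : ℝ)⌉₊ 0 r (fun _ => 1) (fun _ => 1) :=
  stub_unitPotentialHard_lp Literature.Computability.Complexity.rothvoss_matching_slack_bound_holds

end Summit.PneNP.PneNP.Cruxes.ConvexGateBlind.StrictRankConicCover
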